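import Summits.AtomisticToContinuum.Crystallization.Theses.BraggSlacknessRigidity
import Summits.AtomisticToContinuum.Crystallization.Theorems.ThreeConeCertificateExactCertificateNoGapNecessary
import Summits.AtomisticToContinuum.Crystallization.Theorems.ThreeConeCertificateExactCertificateNoGapPeriodic
import Summits.AtomisticToContinuum.Crystallization.Theorems.BraggSlacknessRigiditySlacknessTransferFourier

/-!
# Crux `StrictCertificate` (stmt-AtomisticToContinuum-13167, route `BraggSlacknessRigidity`):
# the crux as "strict design at an hcp template", and the necessity of template minimality

Support file for the line `registered` (birth skeleton `Cruxes/StrictCertificate/Lines/birth.lean`,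
stubs `stub_hcpPeriodicMinimum`, `stub_strictDesign`).  Nothing here closes the item.  Writing
`Min(a,h)` for "`hcp(a,h)` minimises the Lennard-Jones energy per particle among all periodic
configurations of `ℝ³`" (the body of `stub_hcpPeriodicMinimum`) and `Design(a,h)` for the conclusion of
`stub_strictDesign` (a range `ρ > 0`, a tail interpolant `f` carrying the crux's Fourier package, a strict
continuous core penalty `Uc`, one-sided strict tail contact, and the charged periodic core bound
`e_LJ(hcp(a,h)) + f 0/2 ≤ e_Q((V_LJ − f − Uc)·1_{(0,ρ)})` for every periodic `Q`), we prove, kernel-checked: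

* `isSplit_of_design` — the normal-form split `g := (V_LJ − f − Uc)·1_{(0,ρ)}`,
  `U := Uc·1_{(0,ρ)} + (V_LJ − f)·1_{[ρ,∞)}`, `c := −(e_LJ(P) + f 0/2)` of a design is a three-cone split
  (`ExactCertificateNegative.IsSplit`): positive type is DERIVED from `𝓕F ≥ 0` (`posType_of_fourier`,
  Bochner's easy direction by Fourier inversion) and finite-`N` stability is DERIVED from the periodic
  core bound by periodisation (`NoGap.stable_of_periodic_bound`);
* `strictCertificate_of_design` — **`Design(a,h) → StrictCertificate`** (minimality is NOT needed as a
  hypothesis: it is an OUTPUT, `hcpPeriodicMinimum_of_design`);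
* `exists_design_of_strictCertificate` — **`StrictCertificate → ∃ (a,h), Min(a,h) ∧ Design(a,h)`** (read the
  design off the witness at range `max ρ 1`, `Uc := U`; the core bound is weak duality
  `Slackness.const_le_energyPerParticle_of_stable`; minimality is complementary slackness
  `Slackness.witness_eq`);
* hence `strictCertificate_iff_exists_design` — **the crux IS "some hcp template carries a strict design"**,
  and `strictCertificate_of_stubs` — the registered skeleton's composition
  `stub_hcpPeriodicMinimum → stub_strictDesign → StrictCertificate` as a one-liner;
* NECESSITY of the first stub and what it contains: `hcpPeriodicMinimum_of_strictCertificate`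
  (**`StrictCertificate → stub_hcpPeriodicMinimum`**), `crysPeriodicMinAttained_of_strictCertificate`
  (**`StrictCertificate →` the signature of item stmt-AtomisticToContinuum-0627**, the attained-minimum
  half of conjunct (i) of the sub-problem) and `keplerBound_of_strictCertificate`
  (**`StrictCertificate → KeplerBound`**, item 11961).

So the skeleton's only information loss is the quantifier over minimising templates (`∃` in the crux,
`∀` in `stub_strictDesign`), `stub_strictDesign` read at one template is the crux at that template, and no
proof of the crux can avoid item 0627.  `posType_of_fourier`, `continuousOn_of_radial` and the assembly are
adapted from the planner's birth skeleton (`Cruxes/StrictCertificate/Lines/birth.lean`).  All `[folklore]`.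
-/

noncomputable section

namespace Summit.AtomisticToContinuum.Crystallization.Theorems.BraggSlacknessRigidityStrictCertificate

open Literature.MathematicalPhysics.StatisticalMechanics
open Summit.AtomisticToContinuum.Crystallization.Theses.BraggSlacknessRigidity
open Summit.AtomisticToContinuum.Crystallization.Theorems.BraggSlacknessTransfer (phase_sub)
open Summit.AtomisticToContinuum.Crystallization.Theorems.ThreeConeCertificateExactCertificate.NoGap
  (stable_of_periodic_bound)
open Summit.AtomisticToContinuum.Crystallization.Theorems.ThreeConeCertificateExactCertificate.Slackness
  (witness_eq const_le_energyPerParticle_of_stable energyPerParticle_congr_points)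
open Summit.AtomisticToContinuum.Crystallization.Theorems.ExactCertificateNegative (IsSplit)
open Summit.AtomisticToContinuum.Crystallization.Theorems.ChargedEnergyGapNegative (E3 eStar eStar_le)
open MeasureTheory
open scoped BigOperators FourierTransform RealInnerProductSpace ComplexConjugate

/-! ## Two analytic tools (adapted from the birth skeleton) -/

/-- **Bochner, easy direction (weighted quadratic-form identity).** A radial `f` whose profile
`F = f ∘ ‖·‖ : ℝ³ → ℂ` is continuous and integrable with integrable, real, non-negative Fourier transform is
of positive type as a function of the distance: `∑ᵢ∑ⱼ wᵢ wⱼ f(|yᵢ − yⱼ|) ≥ 0` for all finite real forms.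
Proof: Fourier inversion termwise, `∑ᵢⱼ wᵢwⱼ F(yᵢ−yⱼ) = ∫ 𝓕F(ξ)|∑ⱼ wⱼ e^{2πi⟨ξ,yⱼ⟩}|² dξ ≥ 0`. [folklore] -/
theorem posType_of_fourier {f : ℝ → ℝ}
    (hFc : Continuous fun v : E3 => (f ‖v‖ : ℂ))
    (hFi : Integrable fun v : E3 => (f ‖v‖ : ℂ))
    (hFF : Integrable (𝓕 fun v : E3 => (f ‖v‖ : ℂ)))
    (hre : ∀ ξ : E3, (𝓕 (fun v : E3 => (f ‖v‖ : ℂ)) ξ).im = 0 ∧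
      0 ≤ (𝓕 (fun v : E3 => (f ‖v‖ : ℂ)) ξ).re)
    (n : ℕ) (y : Fin n → E3) (w : Fin n → ℝ) :
    0 ≤ ∑ i, ∑ j, w i * w j * f (dist (y i) (y j)) := by
  -- adapted from Cruxes/StrictCertificate/Lines/birth.lean (planner-skel-stmt-AtomisticToContinuum-13167-0)
  set F : E3 → ℂ := fun v => (f ‖v‖ : ℂ) with hFdef
  have hinv : 𝓕⁻ (𝓕 F) = F := hFc.fourierInv_fourier_eq hFi hFF
  have hterm : ∀ u : E3,
      F u = ∫ ξ : E3, Complex.exp (↑(2 * Real.pi * ⟪ξ, u⟫) * Complex.I) * 𝓕 F ξ := by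
    intro u
    have h1 : F u = 𝓕⁻ (𝓕 F) u := by rw [hinv]
    rw [h1, Real.fourierInv_eq']
    simp only [smul_eq_mul]
  have hint : ∀ u : E3,
      Integrable fun ξ : E3 => Complex.exp (↑(2 * Real.pi * ⟪ξ, u⟫) * Complex.I) * 𝓕 F ξ := by
    intro u
    refine hFF.bdd_mul (c := 1) ?_ (ae_of_all _ fun ξ => ?_)
    · exact Continuous.aestronglyMeasurable (by fun_prop)
    · exact (Complex.norm_exp_ofReal_mul_I _).le
  set A : E3 → ℂ := fun ξ => ∑ j, (w j : ℂ) * Complex.exp (2 * Real.pi * Complex.I * (⟪ξ, y j⟫ : ℂ))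
    with hAdef
  have hA : ∀ ξ : E3,
      ∑ i, ∑ j, (w i : ℂ) * (w j : ℂ) * Complex.exp (↑(2 * Real.pi * ⟪ξ, y i - y j⟫) * Complex.I) =
        ((‖A ξ‖ ^ 2 : ℝ) : ℂ) := by
    intro ξ
    rw [← Complex.normSq_eq_norm_sq, ← Complex.mul_conj, hAdef]
    simp only [map_sum, map_mul, Complex.conj_ofReal, Finset.sum_mul_sum]
    refine Finset.sum_congr rfl fun i _ => Finset.sum_congr rfl fun j _ => ?_
    rw [phase_sub]
    ring
  have hid : (∑ i, ∑ j, ((w i * w j * f (dist (y i) (y j)) : ℝ) : ℂ)) =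
      ∫ ξ : E3, 𝓕 F ξ * ((‖A ξ‖ ^ 2 : ℝ) : ℂ) := by
    calc (∑ i, ∑ j, ((w i * w j * f (dist (y i) (y j)) : ℝ) : ℂ))
        = ∑ i, ∑ j, (w i : ℂ) * (w j : ℂ) * F (y i - y j) := by
          refine Finset.sum_congr rfl fun i _ => Finset.sum_congr rfl fun j _ => ?_
          simp [hFdef, dist_eq_norm]
      _ = ∑ i, ∑ j, ∫ ξ : E3, (w i : ℂ) * (w j : ℂ) *
            (Complex.exp (↑(2 * Real.pi * ⟪ξ, y i - y j⟫) * Complex.I) * 𝓕 F ξ) := by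
          refine Finset.sum_congr rfl fun i _ => Finset.sum_congr rfl fun j _ => ?_
          rw [integral_const_mul, ← hterm]
      _ = ∑ i, ∫ ξ : E3, ∑ j, (w i : ℂ) * (w j : ℂ) *
            (Complex.exp (↑(2 * Real.pi * ⟪ξ, y i - y j⟫) * Complex.I) * 𝓕 F ξ) :=
          Finset.sum_congr rfl fun i _ =>
            (integral_finsetSum _ fun j _ => (hint _).const_mul _).symm
      _ = ∫ ξ : E3, ∑ i, ∑ j, (w i : ℂ) * (w j : ℂ) *
            (Complex.exp (↑(2 * Real.pi * ⟪ξ, y i - y j⟫) * Complex.I) * 𝓕 F ξ) :=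
          (integral_finsetSum _ fun i _ =>
            integrable_finsetSum _ fun j _ => (hint _).const_mul _).symm
      _ = ∫ ξ : E3, 𝓕 F ξ * ((‖A ξ‖ ^ 2 : ℝ) : ℂ) := by
          refine integral_congr_ae (ae_of_all _ fun ξ => ?_)
          simp only
          rw [← hA ξ, Finset.mul_sum]
          refine Finset.sum_congr rfl fun i _ => ?_
          rw [Finset.mul_sum]
          refine Finset.sum_congr rfl fun j _ => ?_
          ring
  have hG : (fun ξ : E3 => 𝓕 F ξ * ((‖A ξ‖ ^ 2 : ℝ) : ℂ)) =
      fun ξ : E3 => (((𝓕 F ξ).re * ‖A ξ‖ ^ 2 : ℝ) : ℂ) := by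
    funext ξ
    obtain ⟨him, -⟩ := hre ξ
    generalize ‖A ξ‖ ^ 2 = t
    apply Complex.ext <;> simp [Complex.mul_re, Complex.mul_im, him]
  have key : (∑ i, ∑ j, w i * w j * f (dist (y i) (y j)) : ℝ) =
      ∫ ξ : E3, (𝓕 F ξ).re * ‖A ξ‖ ^ 2 := by
    have h := hid
    rw [hG, integral_complex_ofReal] at h
    exact_mod_cast h
  rw [key]
  exact integral_nonneg fun ξ => mul_nonneg (hre ξ).2 (by positivity)

/-- A continuous radial profile `v ↦ (f ‖v‖ : ℂ)` on `ℝ³` has `f` continuous on every `[ρ, ∞)`, `ρ > 0`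
(restrict to the ray `r ↦ r • e₀`). [folklore] -/
theorem continuousOn_of_radial {f : ℝ → ℝ} (hFc : Continuous fun v : E3 => (f ‖v‖ : ℂ)) {ρ : ℝ}
    (hρ : 0 < ρ) : ContinuousOn f (Set.Ici ρ) := by
  -- adapted from Cruxes/StrictCertificate/Lines/birth.lean (planner-skel-stmt-AtomisticToContinuum-13167-0)
  set e₀ : E3 := EuclideanSpace.single (0 : Fin 3) (1 : ℝ) with he₀
  have he : ‖e₀‖ = 1 := by simp [he₀]
  have h1 : Continuous fun r : ℝ => (f ‖(r • e₀ : E3)‖ : ℂ) := hFc.comp (by fun_prop)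
  have h2 : Continuous fun r : ℝ => f |r| := by
    have h3 : (fun r : ℝ => f |r|) = fun r : ℝ => (f ‖(r • e₀ : E3)‖ : ℂ).re := by
      funext r
      simp [norm_smul, he]
    rw [h3]
    exact Complex.continuous_re.comp h1
  refine h2.continuousOn.congr fun r hr => ?_
  have hr0 : 0 ≤ r := hρ.le.trans hr
  simp [abs_of_nonneg hr0]

/-! ## The normal-form split of a design is a three-cone split -/

/-- **The normal-form split of a design is a three-cone split.**  For ANY periodic `P`, a range `ρ > 0`,
a tail interpolant `f` with the Fourier package (only `𝓕F` real `≥ 0` and the integrabilities are used)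
and `f ≤ V_LJ` on `[ρ,∞)`, a core penalty `Uc ≥ 0` on `(0,ρ)` and the periodic core bound
`e_LJ(P) + f 0/2 ≤ e_Q(g)` for `g := (V_LJ − f − Uc)·1_{(0,ρ)}`: with `U := Uc·1_{(0,ρ)} + (V_LJ − f)·1_{[ρ,∞)}`
and `c := −(e_LJ(P) + f 0/2)`, `(ρ, c, g, U, f)` satisfies (S1)–(S5) — positive type by
`posType_of_fourier`, stability by periodisation (`NoGap.stable_of_periodic_bound`). [folklore] -/
theorem isSplit_of_design {P : PeriodicConfiguration 3} {ρ : ℝ} {f Uc : ℝ → ℝ}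
    (hFc : Continuous fun v : E3 => (f ‖v‖ : ℂ))
    (hFi : Integrable fun v : E3 => (f ‖v‖ : ℂ))
    (hFF : Integrable (𝓕 fun v : E3 => (f ‖v‖ : ℂ)))
    (hre : ∀ ξ : E3, (𝓕 (fun v : E3 => (f ‖v‖ : ℂ)) ξ).im = 0 ∧
      0 ≤ (𝓕 (fun v : E3 => (f ‖v‖ : ℂ)) ξ).re)
    (htail : ∀ r : ℝ, ρ ≤ r → f r ≤ lennardJones r)
    (hUnn : ∀ r : ℝ, 0 < r → r < ρ → 0 ≤ Uc r)
    (hcore : ∀ Q : PeriodicConfiguration 3, P.energyPerParticle lennardJones + f 0 / 2 ≤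
      Q.energyPerParticle (fun r => if r < ρ then lennardJones r - f r - Uc r else 0)) :
    IsSplit ρ (-(P.energyPerParticle lennardJones + f 0 / 2))
      (fun r => if r < ρ then lennardJones r - f r - Uc r else 0)
      (fun r => if r < ρ then Uc r else lennardJones r - f r) f := by
  refine ⟨?_, ?_, ?_, posType_of_fourier hFc hFi hFF hre, ?_⟩
  · -- (S1) the split `V_LJ = g + U + f` on `(0,∞)`
    intro r _
    show lennardJones r = (if r < ρ then lennardJones r - f r - Uc r else 0) +
      (if r < ρ then Uc r else lennardJones r - f r) + f r
    by_cases hr : r < ρ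
    · rw [if_pos hr, if_pos hr]; ring
    · rw [if_neg hr, if_neg hr]; ring
  · -- (S2) `U ≥ 0` on `(0,∞)`
    intro r hr
    show 0 ≤ (if r < ρ then Uc r else lennardJones r - f r)
    by_cases hr' : r < ρ
    · rw [if_pos hr']; exact hUnn r hr hr'
    · rw [if_neg hr', sub_nonneg]; exact htail r (not_lt.1 hr')
  · -- (S3) finite range
    intro r hr
    show (if r < ρ then lennardJones r - f r - Uc r else 0) = 0
    rw [if_neg (not_lt.2 hr)]
  · -- (S5) `c`-stability on all finite injective configurations, by periodisation
    intro N x hx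
    have hW : ∀ r, ρ ≤ r → (fun r => if r < ρ then lennardJones r - f r - Uc r else 0) r = 0 :=
      fun r hr => by
        show (if r < ρ then lennardJones r - f r - Uc r else 0) = 0
        rw [if_neg (not_lt.2 hr)]
    have h1 := stable_of_periodic_bound (κ := P.energyPerParticle lennardJones + f 0 / 2) hW hcore hx
    linarith

/-! ## `Design(a,h) → StrictCertificate` and `Design(a,h) → Min(a,h)` -/

/-- **A strict design at an hcp template gives the crux** — `Design(a,h) → StrictCertificate`, with NO
minimality hypothesis: assemble the normal-form witness `⟨hcp(a,h), ρ, c, g, U, f⟩` (`isSplit_of_design`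
for conjuncts 2–6, `ring` for the value identity, `ContinuousOn.if` gluing at `r = ρ` for the continuity of
`U`, zero-set bookkeeping for strictness of `U`, the Fourier package verbatim). [folklore] -/
theorem strictCertificate_of_design : ∀ (a h : ℝ) (ha : a ≠ 0) (hh : h ≠ 0), (∃ (ρ : ℝ) (f Uc : ℝ → ℝ), 0 < ρ ∧ Continuous (fun v : EuclideanSpace ℝ (Fin 3) => (f ‖v‖ : ℂ)) ∧ MeasureTheory.Integrable (fun v : EuclideanSpace ℝ (Fin 3) => (f ‖v‖ : ℂ)) ∧ MeasureTheory.Integrable (FourierTransform.fourier (fun v : EuclideanSpace ℝ (Fin 3) => (f ‖v‖ : ℂ))) ∧ (∀ ξ : EuclideanSpace ℝ (Fin 3), (FourierTransform.fourier (fun v : EuclideanSpace ℝ (Fin 3) => (f ‖v‖ : ℂ)) ξ).im = 0 ∧ 0 ≤ (FourierTransform.fourier (fun v : EuclideanSpace ℝ (Fin 3) => (f ‖v‖ : ℂ)) ξ).re) ∧ (∀ ξ : EuclideanSpace ℝ (Fin 3), ξ ≠ 0 → (∀ k : EuclideanSpace ℝ (Fin 3), (∀ g ∈ (Literature.MathematicalPhysics.StatisticalMechanics.hcpPeriodicConfiguration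 ha hh).lattice, ∃ n : ℤ, inner ℝ k g = (n : ℝ)) → ‖ξ‖ ≠ ‖k‖) → FourierTransform.fourier (fun v : EuclideanSpace ℝ (Fin 3) => (f ‖v‖ : ℂ)) ξ ≠ 0) ∧ (∀ r : ℝ, ρ ≤ r → f r ≤ Literature.MathematicalPhysics.StatisticalMechanics.lennardJones r) ∧ (∀ r : ℝ, ρ ≤ r → f r = Literature.MathematicalPhysics.StatisticalMechanics.lennardJones r → ∃ p ∈ (Literature.MathematicalPhysics.StatisticalMechanics.hcpPeriodicConfiguration ha hh).points, ∃ q ∈ (Literature.MathematicalPhysics.StatisticalMechanics.hcpPeriodicConfiguration ha hh).points, r = dist p q) ∧ ContinuousOn Uc (Set.Ioc 0 ρ) ∧ (∀ r : ℝ, 0 < r → r < ρ → 0 ≤ Uc r) ∧ (∀ r : ℝ, 0 < r → r < ρ → Uc r = 0 → ∃ p ∈ (Literature.MathematicalPhysics.StatisticalMechanics.hcpPeriodicConfiguration ha hh).points, ∃ q ∈ (Literature.MathematicalPhysics.StatisticalMechanics.hcpPeriodicConfiguration ha hh).points, r = dist p q) ∧ Uc ρ = Literature.MathematicalPhysics.StatisticalMechanics.lennardJones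 ρ - f ρ ∧ (∀ Q : Literature.MathematicalPhysics.StatisticalMechanics.PeriodicConfiguration 3, (Literature.MathematicalPhysics.StatisticalMechanics.hcpPeriodicConfiguration ha hh).energyPerParticle Literature.MathematicalPhysics.StatisticalMechanics.lennardJones + f 0 / 2 ≤ Q.energyPerParticle (fun r => if r < ρ then Literature.MathematicalPhysics.StatisticalMechanics.lennardJones r - f r - Uc r else 0))) → StrictCertificate := by
  intro a h ha hh hD
  obtain ⟨ρ, f, Uc, hρ, hFc, hFi, hFF, hre, hstrictF, htail, htouch, hUc, hUnn, hUzero, hmatch, hcore⟩ :=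
    hD
  set P := hcpPeriodicConfiguration ha hh with hP
  have hs := isSplit_of_design (P := P) hFc hFi hFF hre htail hUnn hcore
  refine ⟨P, ρ, -(P.energyPerParticle lennardJones + f 0 / 2),
    (fun r => if r < ρ then lennardJones r - f r - Uc r else 0),
    (fun r => if r < ρ then Uc r else lennardJones r - f r), f, ⟨a, h, ha, hh, rfl⟩,
    hs.1, hs.2.1, hs.2.2.1, hs.2.2.2.1, hs.2.2.2.2, by ring, ?_, ?_, hFc, hFi, hFF, hre, hstrictF⟩
  · -- (8) continuity of `U` on `(0,∞)`: two continuous pieces glued at `r = ρ`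
    have hV : ContinuousOn lennardJones (Set.Ioi 0) :=
      continuousOn_lennardJones.mono fun r hr => ne_of_gt hr
    have hf : ContinuousOn f (Set.Ici ρ) := continuousOn_of_radial hFc hρ
    show ContinuousOn (fun r => if r < ρ then Uc r else lennardJones r - f r) (Set.Ioi 0)
    refine ContinuousOn.if ?_ ?_ ?_
    · rintro r ⟨-, hr⟩
      have hfr : frontier {s : ℝ | s < ρ} = {ρ} := by
        rw [show {s : ℝ | s < ρ} = Set.Iio ρ from rfl, frontier_Iio]
      rw [hfr, Set.mem_singleton_iff] at hr
      rw [hr, hmatch]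
    · have hcl : closure {s : ℝ | s < ρ} = Set.Iic ρ := by
        rw [show {s : ℝ | s < ρ} = Set.Iio ρ from rfl, closure_Iio]
      rw [hcl]
      exact hUc.mono fun r hr => ⟨hr.1, hr.2⟩
    · have hcl : closure {s : ℝ | ¬ s < ρ} = Set.Ici ρ := by
        rw [show {s : ℝ | ¬ s < ρ} = Set.Ici ρ from Set.ext fun s => not_lt, closure_Ici]
      rw [hcl]
      exact (hV.mono fun r hr => hr.1).sub (hf.mono fun r hr => hr.2)
  · -- (9) strictness of the slack `U`: its zeros on `(0,∞)` are template distances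
    intro r hr hU0
    change (if r < ρ then Uc r else lennardJones r - f r) = 0 at hU0
    by_cases hr' : r < ρ
    · rw [if_pos hr'] at hU0
      exact hUzero r hr hr' hU0
    · rw [if_neg hr'] at hU0
      exact htouch r (not_lt.1 hr') (by linarith)

/-- **A strict design at an hcp template FORCES the template to be a periodic minimiser** —
`Design(a,h) → Min(a,h)`: the normal-form split has value `c + f 0/2 = −e_LJ(hcp(a,h))`, so complementary
slackness (`Slackness.witness_eq`: the value floor `−e* ≤ c + f 0/2` against `e* ≤ e_LJ(P)`) gives
`e_LJ(hcp(a,h)) = e* ≤ e_LJ(Q)`.  (So the minimality HYPOTHESIS of `stub_strictDesign` restricts only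
WHERE a design is asked for; it is never an input to the assembly.) [folklore] -/
theorem hcpPeriodicMinimum_of_design : ∀ (a h : ℝ) (ha : a ≠ 0) (hh : h ≠ 0), (∃ (ρ : ℝ) (f Uc : ℝ → ℝ), 0 < ρ ∧ Continuous (fun v : EuclideanSpace ℝ (Fin 3) => (f ‖v‖ : ℂ)) ∧ MeasureTheory.Integrable (fun v : EuclideanSpace ℝ (Fin 3) => (f ‖v‖ : ℂ)) ∧ MeasureTheory.Integrable (FourierTransform.fourier (fun v : EuclideanSpace ℝ (Fin 3) => (f ‖v‖ : ℂ))) ∧ (∀ ξ : EuclideanSpace ℝ (Fin 3), (FourierTransform.fourier (fun v : EuclideanSpace ℝ (Fin 3) => (f ‖v‖ : ℂ)) ξ).im = 0 ∧ 0 ≤ (FourierTransform.fourier (fun v : EuclideanSpace ℝ (Fin 3) => (f ‖v‖ : ℂ)) ξ).re) ∧ (∀ ξ : EuclideanSpace ℝ (Fin 3), ξ ≠ 0 → (∀ k : EuclideanSpace ℝ (Fin 3), (∀ g ∈ (Literature.MathematicalPhysics.StatisticalMechanics.hcpPeriodicConfiguration ha hh).lattice, ∃ n : ℤ, inner ℝ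 k g = (n : ℝ)) → ‖ξ‖ ≠ ‖k‖) → FourierTransform.fourier (fun v : EuclideanSpace ℝ (Fin 3) => (f ‖v‖ : ℂ)) ξ ≠ 0) ∧ (∀ r : ℝ, ρ ≤ r → f r ≤ Literature.MathematicalPhysics.StatisticalMechanics.lennardJones r) ∧ (∀ r : ℝ, ρ ≤ r → f r = Literature.MathematicalPhysics.StatisticalMechanics.lennardJones r → ∃ p ∈ (Literature.MathematicalPhysics.StatisticalMechanics.hcpPeriodicConfiguration ha hh).points, ∃ q ∈ (Literature.MathematicalPhysics.StatisticalMechanics.hcpPeriodicConfiguration ha hh).points, r = dist p q) ∧ ContinuousOn Uc (Set.Ioc 0 ρ) ∧ (∀ r : ℝ, 0 < r → r < ρ → 0 ≤ Uc r) ∧ (∀ r : ℝ, 0 < r → r < ρ → Uc r = 0 → ∃ p ∈ (Literature.MathematicalPhysics.StatisticalMechanics.hcpPeriodicConfiguration ha hh).points, ∃ q ∈ (Literature.MathematicalPhysics.StatisticalMechanics.hcpPeriodicConfiguration ha hh).points, r = dist p q) ∧ Uc ρ = Literature.MathematicalPhysics.StatisticalMechanics.lennardJones ρ - f ρ ∧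 (∀ Q : Literature.MathematicalPhysics.StatisticalMechanics.PeriodicConfiguration 3, (Literature.MathematicalPhysics.StatisticalMechanics.hcpPeriodicConfiguration ha hh).energyPerParticle Literature.MathematicalPhysics.StatisticalMechanics.lennardJones + f 0 / 2 ≤ Q.energyPerParticle (fun r => if r < ρ then Literature.MathematicalPhysics.StatisticalMechanics.lennardJones r - f r - Uc r else 0))) → (∀ Q : Literature.MathematicalPhysics.StatisticalMechanics.PeriodicConfiguration 3, (Literature.MathematicalPhysics.StatisticalMechanics.hcpPeriodicConfiguration ha hh).energyPerParticle Literature.MathematicalPhysics.StatisticalMechanics.lennardJones ≤ Q.energyPerParticle Literature.MathematicalPhysics.StatisticalMechanics.lennardJones) := by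
  intro a h ha hh hD Q
  obtain ⟨ρ, f, Uc, -, hFc, hFi, hFF, hre, -, htail, -, -, hUnn, -, -, hcore⟩ := hD
  have hs := isSplit_of_design (P := hcpPeriodicConfiguration ha hh) hFc hFi hFF hre htail hUnn hcore
  rw [(witness_eq (P := hcpPeriodicConfiguration ha hh) hs (le_of_eq (by ring))).1]
  exact eStar_le Q

/-! ## The converse at the witness template: `StrictCertificate → ∃ (a,h), Min(a,h) ∧ Design(a,h)` -/

/-- **Reading the strict design off a witness.**  If `⟨hcp(a,h), ρ, c, g, U, f⟩` is a strict certificate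
then `Min(a,h)` holds (`witness_eq`) and `(max ρ 1, f, U)` is a strict design at `hcp(a,h)`: the Fourier
package is verbatim; on `[max ρ 1, ∞)` one has `V_LJ = U + f ≥ f` with equality iff `U = 0`, i.e. only at
template distances (conjunct 9); `U` is the core penalty (continuous, `≥ 0`, zeros in `D_P`,
`U(ρ') = V_LJ(ρ') − f(ρ')`); and the charged core bound is weak duality for the finite-range cone
(`Slackness.const_le_energyPerParticle_of_stable`: `−c ≤ e_Q(g)`) after identifying
`(V_LJ − f − U)·1_{(0,ρ')}` with `g` on `(0,∞)` (`energyPerParticle_congr_points`). [folklore] -/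
theorem exists_design_of_strictCertificate (hS : StrictCertificate) :
    ∃ (a h : ℝ) (ha : a ≠ 0) (hh : h ≠ 0), (∀ Q : Literature.MathematicalPhysics.StatisticalMechanics.PeriodicConfiguration 3, (Literature.MathematicalPhysics.StatisticalMechanics.hcpPeriodicConfiguration ha hh).energyPerParticle Literature.MathematicalPhysics.StatisticalMechanics.lennardJones ≤ Q.energyPerParticle Literature.MathematicalPhysics.StatisticalMechanics.lennardJones) ∧ ∃ (ρ : ℝ) (f Uc : ℝ → ℝ), 0 < ρ ∧ Continuous (fun v : EuclideanSpace ℝ (Fin 3) => (f ‖v‖ : ℂ)) ∧ MeasureTheory.Integrable (fun v : EuclideanSpace ℝ (Fin 3) => (f ‖v‖ : ℂ)) ∧ MeasureTheory.Integrable (FourierTransform.fourier (fun v : EuclideanSpace ℝ (Fin 3) => (f ‖v‖ : ℂ))) ∧ (∀ ξ : EuclideanSpace ℝ (Fin 3), (FourierTransform.fourier (fun v : EuclideanSpace ℝ (Fin 3) => (f ‖v‖ : ℂ)) ξ).im = 0 ∧ 0 ≤ (FourierTransform.fourier (fun v : EuclideanSpace ℝ (Fin 3) => (f ‖v‖ :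 ℂ)) ξ).re) ∧ (∀ ξ : EuclideanSpace ℝ (Fin 3), ξ ≠ 0 → (∀ k : EuclideanSpace ℝ (Fin 3), (∀ g ∈ (Literature.MathematicalPhysics.StatisticalMechanics.hcpPeriodicConfiguration ha hh).lattice, ∃ n : ℤ, inner ℝ k g = (n : ℝ)) → ‖ξ‖ ≠ ‖k‖) → FourierTransform.fourier (fun v : EuclideanSpace ℝ (Fin 3) => (f ‖v‖ : ℂ)) ξ ≠ 0) ∧ (∀ r : ℝ, ρ ≤ r → f r ≤ Literature.MathematicalPhysics.StatisticalMechanics.lennardJones r) ∧ (∀ r : ℝ, ρ ≤ r → f r = Literature.MathematicalPhysics.StatisticalMechanics.lennardJones r → ∃ p ∈ (Literature.MathematicalPhysics.StatisticalMechanics.hcpPeriodicConfiguration ha hh).points, ∃ q ∈ (Literature.MathematicalPhysics.StatisticalMechanics.hcpPeriodicConfiguration ha hh).points, r = dist p q) ∧ ContinuousOn Uc (Set.Ioc 0 ρ) ∧ (∀ r : ℝ, 0 < r → r < ρ → 0 ≤ Uc r) ∧ (∀ r : ℝ, 0 < r → r < ρ → Uc r = 0 → ∃ p ∈ (Literature.MathematicalPhysics.StatisticalMechanics.hcpPeriodicConfiguration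 ha hh).points, ∃ q ∈ (Literature.MathematicalPhysics.StatisticalMechanics.hcpPeriodicConfiguration ha hh).points, r = dist p q) ∧ Uc ρ = Literature.MathematicalPhysics.StatisticalMechanics.lennardJones ρ - f ρ ∧ (∀ Q : Literature.MathematicalPhysics.StatisticalMechanics.PeriodicConfiguration 3, (Literature.MathematicalPhysics.StatisticalMechanics.hcpPeriodicConfiguration ha hh).energyPerParticle Literature.MathematicalPhysics.StatisticalMechanics.lennardJones + f 0 / 2 ≤ Q.energyPerParticle (fun r => if r < ρ then Literature.MathematicalPhysics.StatisticalMechanics.lennardJones r - f r - Uc r else 0)) := by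
  obtain ⟨P, ρ, c, g, U, f, ⟨a, h, ha, hh, rfl⟩, h1, h2, h3, h4, h5, h6, h8, h9, hFc, hFi, hFF, hre,
    hstrictF⟩ := hS
  have hs : IsSplit ρ c g U f := ⟨h1, h2, h3, h4, h5⟩
  have hmin : (∀ Q : Literature.MathematicalPhysics.StatisticalMechanics.PeriodicConfiguration 3, (Literature.MathematicalPhysics.StatisticalMechanics.hcpPeriodicConfiguration ha hh).energyPerParticle Literature.MathematicalPhysics.StatisticalMechanics.lennardJones ≤ Q.energyPerParticle Literature.MathematicalPhysics.StatisticalMechanics.lennardJones) := by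
    intro Q
    rw [(witness_eq hs h6.le).1]
    exact eStar_le Q
  have hρ' : (0 : ℝ) < max ρ 1 := lt_max_of_lt_right one_pos
  refine ⟨a, h, ha, hh, hmin, max ρ 1, f, U, hρ', hFc, hFi, hFF, hre, hstrictF, ?_, ?_, ?_, ?_, ?_, ?_,
    ?_⟩
  · -- one-sided tail contact: `f ≤ V_LJ` on `[max ρ 1, ∞)`
    intro r hr
    have hr0 : 0 < r := lt_of_lt_of_le hρ' hr
    have hV := h1 r hr0
    rw [h3 r ((le_max_left _ _).trans hr)] at hV
    linarith [h2 r hr0]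
  · -- strictness of the contact: `f r = V_LJ r` beyond the range only at template distances
    intro r hr hfr
    have hr0 : 0 < r := lt_of_lt_of_le hρ' hr
    have hV := h1 r hr0
    rw [h3 r ((le_max_left _ _).trans hr)] at hV
    exact h9 r hr0 (by linarith)
  · -- the core penalty is continuous on `(0, max ρ 1]`
    exact h8.mono fun r hr => hr.1
  · -- `≥ 0` on `(0, max ρ 1)`
    exact fun r hr _ => h2 r hr
  · -- zeros are template distances
    exact fun r hr _ hU0 => h9 r hr hU0
  · -- gluing value at the range
    have hV := h1 (max ρ 1) hρ'
    rw [h3 _ (le_max_left _ _)] at hV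
    linarith
  · -- the charged periodic core bound, by weak duality for the finite-range cone
    intro Q
    have hg : ∀ p ∈ Q.points, ∀ q ∈ Q.points, p ≠ q → g (dist p q) =
        (fun r => if r < max ρ 1 then lennardJones r - f r - U r else 0) (dist p q) := by
      intro p _ q _ hpq
      have hd : 0 < dist p q := dist_pos.2 hpq
      show g (dist p q) = if dist p q < max ρ 1 then lennardJones (dist p q) - f (dist p q) - U (dist p q)
        else 0
      by_cases hlt : dist p q < max ρ 1
      · rw [if_pos hlt]
        have hV := h1 _ hd
        linarith
      · rw [if_neg hlt]
        exact h3 _ ((le_max_left _ _).trans (not_lt.1 hlt))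
    rw [← energyPerParticle_congr_points Q hg]
    have hst : ∀ (N : ℕ) (x : Fin N → E3), Function.Injective x → -c * N ≤ interactionEnergy g x :=
      fun N x hx => by have := h5 N x hx; linarith
    have hwd := const_le_energyPerParticle_of_stable Q h3 hst
    linarith

/-- **The crux IS "some hcp template carries a strict design"**:
`StrictCertificate ↔ ∃ (a,h), Design(a,h)`. [folklore] -/
theorem strictCertificate_iff_exists_design :
    StrictCertificate ↔ ∃ (a h : ℝ) (ha : a ≠ 0) (hh : h ≠ 0), ∃ (ρ : ℝ) (f Uc : ℝ → ℝ), 0 < ρ ∧ Continuous (fun v : EuclideanSpace ℝ (Fin 3) => (f ‖v‖ : ℂ)) ∧ MeasureTheory.Integrable (fun v : EuclideanSpace ℝ (Fin 3) => (f ‖v‖ : ℂ)) ∧ MeasureTheory.Integrable (FourierTransform.fourier (fun v : EuclideanSpace ℝ (Fin 3) => (f ‖v‖ : ℂ))) ∧ (∀ ξ : EuclideanSpace ℝ (Fin 3), (FourierTransform.fourier (fun v : EuclideanSpace ℝ (Fin 3) => (f ‖v‖ : ℂ)) ξ).im = 0 ∧ 0 ≤ (FourierTransform.fourier (fun v : EuclideanSpace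 ℝ (Fin 3) => (f ‖v‖ : ℂ)) ξ).re) ∧ (∀ ξ : EuclideanSpace ℝ (Fin 3), ξ ≠ 0 → (∀ k : EuclideanSpace ℝ (Fin 3), (∀ g ∈ (Literature.MathematicalPhysics.StatisticalMechanics.hcpPeriodicConfiguration ha hh).lattice, ∃ n : ℤ, inner ℝ k g = (n : ℝ)) → ‖ξ‖ ≠ ‖k‖) → FourierTransform.fourier (fun v : EuclideanSpace ℝ (Fin 3) => (f ‖v‖ : ℂ)) ξ ≠ 0) ∧ (∀ r : ℝ, ρ ≤ r → f r ≤ Literature.MathematicalPhysics.StatisticalMechanics.lennardJones r) ∧ (∀ r : ℝ, ρ ≤ r → f r = Literature.MathematicalPhysics.StatisticalMechanics.lennardJones r → ∃ p ∈ (Literature.MathematicalPhysics.StatisticalMechanics.hcpPeriodicConfiguration ha hh).points, ∃ q ∈ (Literature.MathematicalPhysics.StatisticalMechanics.hcpPeriodicConfiguration ha hh).points, r = dist p q) ∧ ContinuousOn Uc (Set.Ioc 0 ρ) ∧ (∀ r : ℝ, 0 < r → r < ρ → 0 ≤ Uc r) ∧ (∀ r : ℝ, 0 < r → r < ρ → Uc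 r = 0 → ∃ p ∈ (Literature.MathematicalPhysics.StatisticalMechanics.hcpPeriodicConfiguration ha hh).points, ∃ q ∈ (Literature.MathematicalPhysics.StatisticalMechanics.hcpPeriodicConfiguration ha hh).points, r = dist p q) ∧ Uc ρ = Literature.MathematicalPhysics.StatisticalMechanics.lennardJones ρ - f ρ ∧ (∀ Q : Literature.MathematicalPhysics.StatisticalMechanics.PeriodicConfiguration 3, (Literature.MathematicalPhysics.StatisticalMechanics.hcpPeriodicConfiguration ha hh).energyPerParticle Literature.MathematicalPhysics.StatisticalMechanics.lennardJones + f 0 / 2 ≤ Q.energyPerParticle (fun r => if r < ρ then Literature.MathematicalPhysics.StatisticalMechanics.lennardJones r - f r - Uc r else 0)) :=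
  ⟨fun hS => by
    obtain ⟨a, h, ha, hh, -, hD⟩ := exists_design_of_strictCertificate hS
    exact ⟨a, h, ha, hh, hD⟩,
   fun ⟨a, h, ha, hh, hD⟩ => strictCertificate_of_design a h ha hh hD⟩

/-- **The registered skeleton's composition as a one-liner**:
`stub_hcpPeriodicMinimum → stub_strictDesign → StrictCertificate` (signatures verbatim). [folklore] -/
theorem strictCertificate_of_stubs : (∃ (a h : ℝ) (ha : a ≠ 0) (hh : h ≠ 0), ∀ Q : Literature.MathematicalPhysics.StatisticalMechanics.PeriodicConfiguration 3, (Literature.MathematicalPhysics.StatisticalMechanics.hcpPeriodicConfiguration ha hh).energyPerParticle Literature.MathematicalPhysics.StatisticalMechanics.lennardJones ≤ Q.energyPerParticle Literature.MathematicalPhysics.StatisticalMechanics.lennardJones) → (∀ (a h : ℝ) (ha : a ≠ 0) (hh : h ≠ 0), (∀ Q : Literature.MathematicalPhysics.StatisticalMechanics.PeriodicConfiguration 3, (Literature.MathematicalPhysics.StatisticalMechanics.hcpPeriodicConfiguration ha hh).energyPerParticle Literature.MathematicalPhysics.StatisticalMechanics.lennardJones ≤ Q.energyPerParticle Literature.MathematicalPhysics.StatisticalMechanics.lennardJones)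 → ∃ (ρ : ℝ) (f Uc : ℝ → ℝ), 0 < ρ ∧ Continuous (fun v : EuclideanSpace ℝ (Fin 3) => (f ‖v‖ : ℂ)) ∧ MeasureTheory.Integrable (fun v : EuclideanSpace ℝ (Fin 3) => (f ‖v‖ : ℂ)) ∧ MeasureTheory.Integrable (FourierTransform.fourier (fun v : EuclideanSpace ℝ (Fin 3) => (f ‖v‖ : ℂ))) ∧ (∀ ξ : EuclideanSpace ℝ (Fin 3), (FourierTransform.fourier (fun v : EuclideanSpace ℝ (Fin 3) => (f ‖v‖ : ℂ)) ξ).im = 0 ∧ 0 ≤ (FourierTransform.fourier (fun v : EuclideanSpace ℝ (Fin 3) => (f ‖v‖ : ℂ)) ξ).re) ∧ (∀ ξ : EuclideanSpace ℝ (Fin 3), ξ ≠ 0 → (∀ k : EuclideanSpace ℝ (Fin 3), (∀ g ∈ (Literature.MathematicalPhysics.StatisticalMechanics.hcpPeriodicConfiguration ha hh).lattice, ∃ n : ℤ, inner ℝ k g = (n : ℝ)) → ‖ξ‖ ≠ ‖k‖) → FourierTransform.fourier (fun v : EuclideanSpace ℝ (Fin 3) => (f ‖v‖ : ℂ)) ξ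 ≠ 0) ∧ (∀ r : ℝ, ρ ≤ r → f r ≤ Literature.MathematicalPhysics.StatisticalMechanics.lennardJones r) ∧ (∀ r : ℝ, ρ ≤ r → f r = Literature.MathematicalPhysics.StatisticalMechanics.lennardJones r → ∃ p ∈ (Literature.MathematicalPhysics.StatisticalMechanics.hcpPeriodicConfiguration ha hh).points, ∃ q ∈ (Literature.MathematicalPhysics.StatisticalMechanics.hcpPeriodicConfiguration ha hh).points, r = dist p q) ∧ ContinuousOn Uc (Set.Ioc 0 ρ) ∧ (∀ r : ℝ, 0 < r → r < ρ → 0 ≤ Uc r) ∧ (∀ r : ℝ, 0 < r → r < ρ → Uc r = 0 → ∃ p ∈ (Literature.MathematicalPhysics.StatisticalMechanics.hcpPeriodicConfiguration ha hh).points, ∃ q ∈ (Literature.MathematicalPhysics.StatisticalMechanics.hcpPeriodicConfiguration ha hh).points, r = dist p q) ∧ Uc ρ = Literature.MathematicalPhysics.StatisticalMechanics.lennardJones ρ - f ρ ∧ (∀ Q : Literature.MathematicalPhysics.StatisticalMechanics.PeriodicConfiguration 3, (Literature.MathematicalPhysics.StatisticalMechanics.hcpPeriodicConfiguration ha hh).energyPerParticle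 Literature.MathematicalPhysics.StatisticalMechanics.lennardJones + f 0 / 2 ≤ Q.energyPerParticle (fun r => if r < ρ then Literature.MathematicalPhysics.StatisticalMechanics.lennardJones r - f r - Uc r else 0))) → Summit.AtomisticToContinuum.Crystallization.Theses.BraggSlacknessRigidity.StrictCertificate :=
  fun ⟨a, h, ha, hh, hmin⟩ h₂ => strictCertificate_of_design a h ha hh (h₂ a h ha hh hmin)

/-! ## Necessity of `stub_hcpPeriodicMinimum`, and what it contains -/

/-- **`StrictCertificate → stub_hcpPeriodicMinimum`** (signature of the registered stub, verbatim): the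
first stub of the line is NECESSARY for the crux — the witness template is a periodic minimiser by
complementary slackness. [folklore] -/
theorem hcpPeriodicMinimum_of_strictCertificate (hS : StrictCertificate) : ∃ (a h : ℝ) (ha : a ≠ 0) (hh : h ≠ 0), ∀ Q : Literature.MathematicalPhysics.StatisticalMechanics.PeriodicConfiguration 3, (Literature.MathematicalPhysics.StatisticalMechanics.hcpPeriodicConfiguration ha hh).energyPerParticle Literature.MathematicalPhysics.StatisticalMechanics.lennardJones ≤ Q.energyPerParticle Literature.MathematicalPhysics.StatisticalMechanics.lennardJones := by
  obtain ⟨a, h, ha, hh, hmin, -⟩ := exists_design_of_strictCertificate hS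
  exact ⟨a, h, ha, hh, hmin⟩

/-- **`StrictCertificate →` item stmt-AtomisticToContinuum-0627 `crys_periodic_min_attained`** (its
signature verbatim): the crux contains the attained-minimum half of conjunct (i) of the sub-problem
(`HasPeriodicGroundStateEnergy lennardJones 3`), with the minimiser named: `P = hcp(a,h)`. [folklore] -/
theorem crysPeriodicMinAttained_of_strictCertificate (hS : StrictCertificate) : ∃ P : Literature.MathematicalPhysics.StatisticalMechanics.PeriodicConfiguration 3, IsLeast (Set.range fun Q : Literature.MathematicalPhysics.StatisticalMechanics.PeriodicConfiguration 3 => Q.energyPerParticle Literature.MathematicalPhysics.StatisticalMechanics.lennardJones) (P.energyPerParticle Literature.MathematicalPhysics.StatisticalMechanics.lennardJones) := by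
  obtain ⟨a, h, ha, hh, hmin⟩ := hcpPeriodicMinimum_of_strictCertificate hS
  refine ⟨hcpPeriodicConfiguration ha hh, ⟨hcpPeriodicConfiguration ha hh, rfl⟩, ?_⟩
  rintro _ ⟨Q, rfl⟩
  exact hmin Q

/-- **`StrictCertificate → KeplerBound`** (route item stmt-AtomisticToContinuum-11961): the finite-`N`
certificate bound `−(c + f 0/2)·N ≤ E_LJ(x)` (`IsSplit.kepler`) with `c + f 0/2 = −e_LJ(P)`. [folklore] -/
theorem keplerBound_of_strictCertificate (hS : StrictCertificate) : KeplerBound := by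
  obtain ⟨P, ρ, c, g, U, f, -, h1, h2, h3, h4, h5, h6, -⟩ := hS
  refine ⟨P, fun N x hx => ?_⟩
  have hs : IsSplit ρ c g U f := ⟨h1, h2, h3, h4, h5⟩
  have hk := hs.kepler hx
  have h7 : (N : ℝ) * P.energyPerParticle lennardJones = -((c + f 0 / 2) * N) := by
    rw [show P.energyPerParticle lennardJones = -(c + f 0 / 2) by linarith]
    ring
  linarith

end Summit.AtomisticToContinuum.Crystallization.Theorems.BraggSlacknessRigidityStrictCertificate

end
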